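import Literature.AlgebraicGeometry.DuqueFrancoVillaflor2025.ArtinianGorensteinIdeal
import Literature.AlgebraicGeometry.Kloosterman2025.PencilOfPairingsQuotient
import Mathlib.RingTheory.TensorProduct.MvPolynomial
import Mathlib.LinearAlgebra.BilinearForm.Properties
import HarnessLib

/-!
# The Artinian Gorenstein algebra of a join is the tensor product (Duque Franco–Villaflor 2025, Thm. 1.1)

J. Duque Franco, R. Villaflor Loyola, *Periods of join algebraic cycles*, Ann. Sc. Norm. Super. Pisa Cl. Sci.
(2025), doi:10.2422/2036-2145.202409_029 = arXiv:2312.17222 [DuqueFrancoVillaflor2025Join] (text read: arXiv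
version, pp. 2–3 and 11). Setting: `X₁ = {f(x) = 0} ⊆ ℙ^{k+1}`, `X₂ = {g(y) = 0} ⊆ ℙ^{n−k−1}`,
`X = {f(x) + g(y) = 0} ⊆ ℙ^{n+1}` (DISJOINT sets of variables `x`, `y`), `J(Z₁,Z₂)` the join, and (Def. 2.2)
`J^{F,λ} := (J^F : P_λ)`, `R^{F,λ} := ℂ[x]/J^{F,λ}` the Artinian Gorenstein ideal / algebra of a Hodge cycle.

> **Theorem 1.1.** Let `Z₁ ∈ CH^{k/2}(X₁)` and `Z₂ ∈ CH^{(n−k−2)/2}(X₂)`, then `J(Z₁,Z₂) ∈ CH^{n/2}(X)`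
> satisfies `P_{J(Z₁,Z₂)} = P_{Z₁} · P_{Z₂}`. Furthermore, if `δ ∈ H^{n/2,n/2}(X,ℚ)_prim` then
> `R^{f+g,δ} = R^{f,[Z₁]} ⊗ R^{g,[Z₂]} ⟺ δ = c·[J(Z₁,Z₂)]_prim` for some `c ∈ ℚ^×`.

Printed proof of the second part (p. 11): "Now if an element `T ∈ R^{f+g}_e` is zero in
`R^{f+g,δ} = R^{f,[Z₁]} ⊗ R^{g,[Z₂]}` then `T = Σ_i T_i(x)·Ť_{e−i}(y)` where … for each `i` we have
`T_i ∈ (J^f : P_{Z₁})` or `Ť_{e−i} ∈ (J^g : P_{Z₂})`. Hence such a `T` satisfies `T·P_{Z₁}·P_{Z₂} = 0 ∈ R^{f+g}`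
and so `J^{f+g,δ} ⊆ (J^{f+g}, P_{Z₁}·P_{Z₂}) = J^{f+g,[J(Z₁,Z₂)]}`. Since both are Artinian Gorenstein ideals of
socle in degree `(d−2)(n/2+1)`, they are equal"; and earlier in the same proof: "Since `R^{f+g} = R^f ⊗ R^g` …
Since `R^{f+g}` is Artinian Gorenstein of socle in degree `(d−2)(n+2)`".

**What this file proves** — the ALGEBRAIC CORE of Theorem 1.1, i.e. the identity of ideals of `K[x ⊔ y]`
`(J^{f+g} : P_{Z₁}P_{Z₂}) = J^{f,[Z₁]}·K[x ⊔ y] + J^{g,[Z₂]}·K[x ⊔ y]` (equivalently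
`R^{f+g,[J(Z₁,Z₂)]} = R^{f,[Z₁]} ⊗ R^{g,[Z₂]}`) together with "`R^f ⊗ R^g` is Artinian Gorenstein of socle the
sum of the socles", in the functional (Macaulay inverse system) language of the tree files
`Kloosterman2025/ArtinianGorensteinOfFunctional.lean` (`annIdeal ℓ`) and
`DuqueFrancoVillaflor2025/ArtinianGorensteinIdeal.lean` (`IsArtinianGorenstein I σ`; every Artinian
Gorenstein ideal is `annIdeal ℓ`, Iarrobino–Kanev Lemma 2.14). Over ANY field `K`, for functionals
`ℓ₁ : K[x_σ] → K`, `ℓ₂ : K[y_τ] → K` and the polynomial tensor model `K[x_σ] ⊗_K K[y_τ] ≃ K[x ⊔ y]`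
(Mathlib `MvPolynomial.tensorEquivSum`; `x ↔ Sum.inl`, `y ↔ Sum.inr`):

* `tensorFunctional ℓ₁ ℓ₂ : K[x ⊔ y] → K`, the functional `ℓ₁ ⊗ ℓ₂`:
  `(ℓ₁ ⊗ ℓ₂)(p(x)·q(y)) = ℓ₁(p)·ℓ₂(q)` (`tensorFunctional_mul_rename`) — if `ℓ_f`, `ℓ_g` are socle generators
  of `R^f`, `R^g` (e.g. `det Hess`-coefficients), `ℓ_f ⊗ ℓ_g` is one of `R^{f+g}` ("`det Hess(f+g) =
  det Hess(f)·det Hess(g)`");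
* **`annIdeal_tensorFunctional`**: `Ann(ℓ₁ ⊗ ℓ₂) = Ann(ℓ₁)·S + Ann(ℓ₂)·S` (`S = K[x ⊔ y]`), whenever
  `K[y]/Ann(ℓ₂)` is finite-dimensional (automatic for a functional concentrated in one degree, finitely many
  variables: `finiteDimensional_quotient_annIdeal`) — this is "`R^{f+g,δ} = R^{f,[Z₁]} ⊗ R^{g,[Z₂]}`" for the
  functional `δ = ℓ₁ ⊗ ℓ₂`; the inclusion `⊇` is the printed sentence "such a `T` satisfies `T·P_{Z₁}·P_{Z₂} = 0`",
  the inclusion `⊆` is proved here by the perfect pairing of `R^{g,[Z₂]}` (dual bases), where the paper concludes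
  by comparing socle degrees of two Artinian Gorenstein ideals;
* **`colon_map_sup_map_annIdeal`** — THE PRINTED IDENTITY: for all `P ∈ K[x]`, `Q ∈ K[y]`,
  `((Ann ℓ₁·S + Ann ℓ₂·S) : P·Q) = (Ann ℓ₁ : P)·S + (Ann ℓ₂ : Q)·S`; with `Ann ℓ_f = J^f`, `Ann ℓ_g = J^g`
  (Macaulay; for the Fermat polynomial this is the tree's `annIdeal_fermatSocleFunctional`) and
  `J^{f+g} = J^f·S + J^g·S` this reads `(J^{f+g} : P_{Z₁}·P_{Z₂}) = (J^f : P_{Z₁})·S + (J^g : P_{Z₂})·S`, i.e.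
  `J^{f+g,[J(Z₁,Z₂)]} = J^{f,[Z₁]}·S + J^{g,[Z₂]}·S` granted `P_{J(Z₁,Z₂)} = P_{Z₁}·P_{Z₂}` (the first, transcendental,
  part of Thm. 1.1, NOT formalised); the same for Artinian Gorenstein ideals: `IsArtinianGorenstein.colon_join`;
* **`isArtinianGorenstein_join`**: `I₁` Artinian Gorenstein of socle `σ₁` in `K[x]`, `I₂` of socle `σ₂` in
  `K[y]` ⟹ `I₁·S + I₂·S` is Artinian Gorenstein of socle `σ₁ + σ₂` in `K[x ⊔ y]` ("`R^{f+g} = R^f ⊗ R^g` is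
  Artinian Gorenstein of socle `(d−2)(n+2) = (d−2)(k+2) + (d−2)(n−k)`"; the tensor product of two Poincaré
  duality algebras is a Poincaré duality algebra of formal dimension the sum,
  [cite: MeyerSmith2005, §I.1 (paragraph after Lemma I.1.1)]): `tensorFunctional_homogeneousComponent`
  (`ℓ₁ ⊗ ℓ₂` is concentrated in degree `t₁ + t₂`), `tensorFunctional_ne_zero`.

NOT formalised: periods / residues (`P_Z`, Thm. 1.2), the first assertion `P_{J(Z₁,Z₂)} = P_{Z₁}·P_{Z₂}` and the
converse direction "`⟹ δ = c·[J(Z₁,Z₂)]_prim`" of Thm. 1.1 (which rest on Thm. 1.2 and [villaflor2021periods]),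
the Hilbert-function corollary Cor. 6.1 (its combinatorial layer is the tree file `JoinHilbertFunction.lean`).
HONEST FRAMING (cell pub-hlocus): certified instances and evidence bearing on the general Hodge conjecture; no
claim.
-/

noncomputable section

open MvPolynomial Module TensorProduct Literature.RingTheory.MvPolynomial
  Literature.AlgebraicGeometry.Kloosterman2025

attribute [local instance] MvPolynomial.gradedAlgebra

namespace Literature.AlgebraicGeometry.DuqueFrancoVillaflor2025

/-! ## Dual families for the perfect pairing of `A/Ann(ℓ)` (finite-dimensional case) -/

section DualFamilies

variable {K : Type*} [Field K] {A : Type*} [CommRing A] [Algebra K A]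

/-- The multiplication pairing `(u,v) ↦ ℓ(uv)` descends to `A/Ann(ℓ)` (it is killed by `Ann(ℓ)` on both
sides). [folklore; cf. [cite: Kloosterman2025, Lemma 2.1]] -/
def quotientMulForm (ℓ : A →ₗ[K] K) :
    LinearMap.BilinForm K (A ⧸ (annIdeal ℓ).restrictScalars K) :=
  quotientPairing (mulForm ℓ) ((annIdeal ℓ).restrictScalars K) ((annIdeal ℓ).restrictScalars K)
    (le_of_eq (ker_mulForm ℓ).symm) (le_of_eq (ker_mulForm_flip ℓ).symm)

/-- `quotientMulForm ℓ [u] [v] = ℓ(uv)`. [folklore; cf. [cite: Kloosterman2025, Lemma 2.1]] -/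
@[simp] theorem quotientMulForm_mk (ℓ : A →ₗ[K] K) (u v : A) :
    quotientMulForm ℓ (Submodule.Quotient.mk u) (Submodule.Quotient.mk v) = ℓ (u * v) := by
  simp [quotientMulForm]

/-- The descended pairing on `A/Ann(ℓ)` is nondegenerate (this is the definition of `Ann(ℓ)`: the radical of
`(u,v) ↦ ℓ(uv)`). [folklore; cf. [cite: Kloosterman2025, Lemma 2.1]] -/
theorem nondegenerate_quotientMulForm (ℓ : A →ₗ[K] K) : (quotientMulForm ℓ).Nondegenerate := by
  constructor
  · intro x hx
    obtain ⟨u, rfl⟩ := Submodule.Quotient.mk_surjective _ x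
    refine (Submodule.Quotient.mk_eq_zero _).mpr ?_
    change u ∈ annIdeal ℓ
    intro v
    simpa using hx (Submodule.Quotient.mk v)
  · intro y hy
    obtain ⟨v, rfl⟩ := Submodule.Quotient.mk_surjective _ y
    refine (Submodule.Quotient.mk_eq_zero _).mpr ?_
    change v ∈ annIdeal ℓ
    intro u
    rw [mul_comm]
    simpa using hy (Submodule.Quotient.mk u)

/-- **Dual families.** If `A/Ann(ℓ)` is finite-dimensional there are `b₁,…,b_n, c₁,…,c_n ∈ A` with
`ℓ(c_i b_j) = δ_{ij}` such that every `v ∈ A` satisfies `v ≡ Σ_i ℓ(v b_i)·c_i (mod Ann(ℓ))` — lifts of a basis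
of `A/Ann(ℓ)` and of its dual basis for the perfect pairing `(u,v) ↦ ℓ(uv)` (clause (iii) of Def. 2.1).
[folklore; cf. [cite: DuqueFrancoVillaflor2025Join, Definition 2.1 (iii)]] -/
theorem exists_dual_families (ℓ : A →ₗ[K] K)
    [FiniteDimensional K (A ⧸ (annIdeal ℓ).restrictScalars K)] :
    ∃ (n : ℕ) (b c : Fin n → A), (∀ i j, ℓ (c i * b j) = if j = i then 1 else 0) ∧
      ∀ v : A, v - ∑ i, ℓ (v * b i) • c i ∈ annIdeal ℓ := by
  classical
  set N : Submodule K A := (annIdeal ℓ).restrictScalars K with hN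
  set V := A ⧸ N
  let β : LinearMap.BilinForm K V := quotientMulForm ℓ
  have hβ : β.Nondegenerate := nondegenerate_quotientMulForm ℓ
  let bV : Basis (Fin (finrank K V)) K V := Module.finBasis K V
  let cV : Basis (Fin (finrank K V)) K V := β.dualBasis hβ bV
  have hsurj : Function.Surjective (Submodule.Quotient.mk (p := N) : A → V) :=
    Submodule.Quotient.mk_surjective N
  refine ⟨finrank K V, fun i => Function.surjInv hsurj (bV i), fun i => Function.surjInv hsurj (cV i),
    fun i j => ?_, fun v => ?_⟩
  · rw [← quotientMulForm_mk, Function.surjInv_eq hsurj, Function.surjInv_eq hsurj]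
    exact LinearMap.BilinForm.apply_dualBasis_left hβ bV i j
  · change v - ∑ i, ℓ (v * Function.surjInv hsurj (bV i)) • Function.surjInv hsurj (cV i) ∈ N
    have hrepr : ∀ i, ℓ (v * Function.surjInv hsurj (bV i)) = cV.repr (Submodule.Quotient.mk v) i := by
      intro i
      rw [LinearMap.BilinForm.dualBasis_repr_apply, ← quotientMulForm_mk, Function.surjInv_eq hsurj]
    have hmk : N.mkQ (v - ∑ i, ℓ (v * Function.surjInv hsurj (bV i)) • Function.surjInv hsurj (cV i)) = 0 := by
      simp only [map_sub, map_sum, map_smul, Submodule.mkQ_apply, Function.surjInv_eq hsurj, hrepr]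
      rw [cV.sum_repr, sub_self]
    rw [Submodule.mkQ_apply, Submodule.Quotient.mk_eq_zero] at hmk
    exact hmk

end DualFamilies

/-! ## The polynomial tensor model `K[x_σ] ⊗ K[y_τ] ≃ K[x ⊔ y]` and the functional `ℓ₁ ⊗ ℓ₂` -/

section Tensor

variable {K : Type*} [Field K] {σ τ : Type*}

/-- `tensorEquivSum (p ⊗ q) = p(x)·q(y)` (Mathlib's polynomial tensor model on pure tensors; the same
computation as the tree's `Literature.RepresentationTheory.tensorEquivSum_tmul`, reproved here to keep this
file's imports inside commutative algebra). [folklore] -/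
private theorem tensorEquivSum_tmul_eq (p : MvPolynomial σ K) (q : MvPolynomial τ K) :
    tensorEquivSum K σ τ K (p ⊗ₜ q) = rename Sum.inl p * rename Sum.inr q := by
  have h₁ : (tensorEquivSum K σ τ K).toAlgHom.comp Algebra.TensorProduct.includeLeft = rename Sum.inl :=
    MvPolynomial.algHom_ext fun i => by simp [Algebra.TensorProduct.includeLeft_apply]
  have h₂ : (tensorEquivSum K σ τ K).toAlgHom.comp
      (Algebra.TensorProduct.includeRight :
        MvPolynomial τ K →ₐ[K] MvPolynomial σ K ⊗[K] MvPolynomial τ K) = rename Sum.inr :=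
    MvPolynomial.algHom_ext fun j => by simp [Algebra.TensorProduct.includeRight_apply]
  have h : p ⊗ₜ[K] q = (p ⊗ₜ[K] (1 : MvPolynomial τ K)) * ((1 : MvPolynomial σ K) ⊗ₜ[K] q) := by
    rw [Algebra.TensorProduct.tmul_mul_tmul, mul_one, one_mul]
  rw [h, map_mul]
  exact congrArg₂ (· * ·) (AlgHom.congr_fun h₁ p) (AlgHom.congr_fun h₂ q)

/-- Two `K`-linear maps on `K[x ⊔ y]` that agree on all products `p(x)·q(y)` are equal — pure tensors span
`K[x] ⊗ K[y] = K[x,y]` ("`S(J(Z₁,Z₂)) = ℂ[x,y]/I(J(Z₁,Z₂)) = ℂ[x]/I(Z₁) ⊗ ℂ[y]/I(Z₂) = S(Z₁) ⊗ S(Z₂)`", the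
coordinate-ring form of the join used throughout the paper). [cite: DuqueFrancoVillaflor2025Join, §1 (display after "in terms of their homogeneous coordinate rings")] -/
theorem linearMap_ext_of_mul_rename {M : Type*} [AddCommMonoid M] [Module K M]
    {f g : MvPolynomial (σ ⊕ τ) K →ₗ[K] M}
    (h : ∀ (p : MvPolynomial σ K) (q : MvPolynomial τ K),
      f (rename Sum.inl p * rename Sum.inr q) = g (rename Sum.inl p * rename Sum.inr q)) : f = g := by
  have hfg : f ∘ₗ (tensorEquivSum K σ τ K).toLinearMap = g ∘ₗ (tensorEquivSum K σ τ K).toLinearMap :=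
    TensorProduct.ext' fun p q => by
      simp only [LinearMap.coe_comp, Function.comp_apply, AlgEquiv.toLinearMap_apply, tensorEquivSum_tmul_eq]
      exact h p q
  refine LinearMap.ext fun x => ?_
  obtain ⟨y, rfl⟩ := (tensorEquivSum K σ τ K).surjective x
  exact LinearMap.congr_fun hfg y

/-- The contraction `id ⊗ ℓ₂ : K[x ⊔ y] = K[x] ⊗ K[y] → K[x]`, "apply `ℓ₂` to the `y`-part".
[cite: DuqueFrancoVillaflor2025Join, Theorem 1.1 (proof)] -/
def tensorContract (ℓ₂ : MvPolynomial τ K →ₗ[K] K) : MvPolynomial (σ ⊕ τ) K →ₗ[K] MvPolynomial σ K :=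
  (TensorProduct.rid K (MvPolynomial σ K)).toLinearMap ∘ₗ LinearMap.lTensor (MvPolynomial σ K) ℓ₂ ∘ₗ
    (tensorEquivSum K σ τ K).symm.toLinearMap

/-- **The functional `ℓ₁ ⊗ ℓ₂` on `K[x ⊔ y]`** (for socle generators `ℓ_f`, `ℓ_g` of `R^f`, `R^g` this is a
socle generator of `R^{f+g} = R^f ⊗ R^g`). [cite: DuqueFrancoVillaflor2025Join, Theorem 1.1 (proof)] -/
def tensorFunctional (ℓ₁ : MvPolynomial σ K →ₗ[K] K) (ℓ₂ : MvPolynomial τ K →ₗ[K] K) :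
    MvPolynomial (σ ⊕ τ) K →ₗ[K] K :=
  ℓ₁ ∘ₗ tensorContract ℓ₂

variable (ℓ₁ : MvPolynomial σ K →ₗ[K] K) (ℓ₂ : MvPolynomial τ K →ₗ[K] K)

/-- `(id ⊗ ℓ₂)(p(x)·q(y)) = ℓ₂(q)·p`. [cite: DuqueFrancoVillaflor2025Join, Theorem 1.1 (proof)] -/
@[simp] theorem tensorContract_mul_rename (p : MvPolynomial σ K) (q : MvPolynomial τ K) :
    tensorContract ℓ₂ (rename Sum.inl p * rename Sum.inr q) = ℓ₂ q • p := by
  change TensorProduct.rid K (MvPolynomial σ K) (LinearMap.lTensor (MvPolynomial σ K) ℓ₂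
    ((tensorEquivSum K σ τ K).symm (rename Sum.inl p * rename Sum.inr q))) = ℓ₂ q • p
  rw [← tensorEquivSum_tmul_eq, AlgEquiv.symm_apply_apply, LinearMap.lTensor_tmul, TensorProduct.rid_tmul]

/-- **`(ℓ₁ ⊗ ℓ₂)(p(x)·q(y)) = ℓ₁(p)·ℓ₂(q)`.** [cite: DuqueFrancoVillaflor2025Join, Theorem 1.1 (proof)] -/
@[simp] theorem tensorFunctional_mul_rename (p : MvPolynomial σ K) (q : MvPolynomial τ K) :
    tensorFunctional ℓ₁ ℓ₂ (rename Sum.inl p * rename Sum.inr q) = ℓ₁ p * ℓ₂ q := by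
  simp [tensorFunctional, mul_comm]

/-- `id ⊗ ℓ₂` is `K[x]`-linear: `(id ⊗ ℓ₂)(h·a(x)) = (id ⊗ ℓ₂)(h)·a`.
[cite: DuqueFrancoVillaflor2025Join, Theorem 1.1 (proof)] -/
theorem tensorContract_mul_rename_inl (h : MvPolynomial (σ ⊕ τ) K) (a : MvPolynomial σ K) :
    tensorContract ℓ₂ (h * rename Sum.inl a) = tensorContract ℓ₂ h * a := by
  have key : tensorContract ℓ₂ ∘ₗ LinearMap.mulRight K (rename Sum.inl a : MvPolynomial (σ ⊕ τ) K) =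
      LinearMap.mulRight K a ∘ₗ tensorContract ℓ₂ :=
    linearMap_ext_of_mul_rename fun p q => by
      simp only [LinearMap.coe_comp, Function.comp_apply, LinearMap.mulRight_apply]
      rw [mul_right_comm, ← map_mul, tensorContract_mul_rename, tensorContract_mul_rename, smul_mul_assoc]
  exact LinearMap.congr_fun key h

/-- … and absorbs `y`-factors into the functional: `(id ⊗ ℓ₂)(h·v(y)) = (id ⊗ ℓ₂(·v))(h)`.
[cite: DuqueFrancoVillaflor2025Join, Theorem 1.1 (proof)] -/
theorem tensorContract_mul_rename_inr (h : MvPolynomial (σ ⊕ τ) K) (v : MvPolynomial τ K) :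
    tensorContract ℓ₂ (h * rename Sum.inr v) = tensorContract (ℓ₂ ∘ₗ LinearMap.mulRight K v) h := by
  have key : tensorContract ℓ₂ ∘ₗ LinearMap.mulRight K (rename Sum.inr v : MvPolynomial (σ ⊕ τ) K) =
      tensorContract (σ := σ) (ℓ₂ ∘ₗ LinearMap.mulRight K v) :=
    linearMap_ext_of_mul_rename fun p q => by
      simp only [LinearMap.coe_comp, Function.comp_apply, LinearMap.mulRight_apply]
      rw [mul_assoc, ← map_mul, tensorContract_mul_rename, tensorContract_mul_rename, LinearMap.comp_apply,
        LinearMap.mulRight_apply]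
  exact LinearMap.congr_fun key h

/-- `(ℓ₁ ⊗ ℓ₂)(h) = ℓ₁((id ⊗ ℓ₂) h)`. [cite: DuqueFrancoVillaflor2025Join, Theorem 1.1 (proof)] -/
theorem tensorFunctional_apply (h : MvPolynomial (σ ⊕ τ) K) :
    tensorFunctional ℓ₁ ℓ₂ h = ℓ₁ (tensorContract ℓ₂ h) := rfl

/-- Multiplying the argument by `P(x)·Q(y)` twists the factors: `(ℓ₁ ⊗ ℓ₂)(· P Q) = ℓ₁(· P) ⊗ ℓ₂(· Q)`
("`PQ·P_{J(Z₁,Z₂)} ≡ PQ·P_{Z₁}P_{Z₂}`": the colon ideal by a product splits factorwise).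
[cite: DuqueFrancoVillaflor2025Join, Theorem 1.1 (proof)] -/
theorem tensorFunctional_comp_mulRight (P : MvPolynomial σ K) (Q : MvPolynomial τ K) :
    tensorFunctional ℓ₁ ℓ₂ ∘ₗ LinearMap.mulRight K (rename Sum.inl P * rename Sum.inr Q) =
      tensorFunctional (ℓ₁ ∘ₗ LinearMap.mulRight K P) (ℓ₂ ∘ₗ LinearMap.mulRight K Q) :=
  linearMap_ext_of_mul_rename fun p q => by
    simp only [LinearMap.coe_comp, Function.comp_apply, LinearMap.mulRight_apply]
    rw [mul_mul_mul_comm, ← map_mul, ← map_mul, tensorFunctional_mul_rename, tensorFunctional_mul_rename,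
      LinearMap.comp_apply, LinearMap.comp_apply, LinearMap.mulRight_apply, LinearMap.mulRight_apply]

/-! ## `Ann(ℓ₁)·S + Ann(ℓ₂)·S ⊆ Ann(ℓ₁ ⊗ ℓ₂)` ("such a `T` satisfies `T·P_{Z₁}·P_{Z₂} = 0`") -/

/-- `Ann(ℓ₁)·S ⊆ Ann(ℓ₁ ⊗ ℓ₂)`: if `ℓ₁(a·K[x]) = 0` then `(ℓ₁ ⊗ ℓ₂)(a·p(x)q(y)) = ℓ₁(ap)ℓ₂(q) = 0`.
[cite: DuqueFrancoVillaflor2025Join, Theorem 1.1 (proof)] -/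
theorem map_rename_inl_annIdeal_le :
    (annIdeal ℓ₁).map (rename Sum.inl) ≤ annIdeal (tensorFunctional ℓ₁ ℓ₂) := by
  rw [Ideal.map_le_iff_le_comap]
  intro a ha h
  have key : tensorFunctional ℓ₁ ℓ₂ ∘ₗ LinearMap.mulLeft K (rename Sum.inl a : MvPolynomial (σ ⊕ τ) K) = 0 :=
    linearMap_ext_of_mul_rename fun p q => by
      simp only [LinearMap.coe_comp, Function.comp_apply, LinearMap.mulLeft_apply, LinearMap.zero_apply]
      rw [← mul_assoc, ← map_mul, tensorFunctional_mul_rename, ha p, zero_mul]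
  simpa using LinearMap.congr_fun key h

/-- `Ann(ℓ₂)·S ⊆ Ann(ℓ₁ ⊗ ℓ₂)`, symmetrically. [cite: DuqueFrancoVillaflor2025Join, Theorem 1.1 (proof)] -/
theorem map_rename_inr_annIdeal_le :
    (annIdeal ℓ₂).map (rename Sum.inr) ≤ annIdeal (tensorFunctional ℓ₁ ℓ₂) := by
  rw [Ideal.map_le_iff_le_comap]
  intro b hb h
  have key : tensorFunctional ℓ₁ ℓ₂ ∘ₗ LinearMap.mulLeft K (rename Sum.inr b : MvPolynomial (σ ⊕ τ) K) = 0 :=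
    linearMap_ext_of_mul_rename fun p q => by
      simp only [LinearMap.coe_comp, Function.comp_apply, LinearMap.mulLeft_apply, LinearMap.zero_apply]
      rw [mul_left_comm, ← map_mul, tensorFunctional_mul_rename, hb q, mul_zero]
  simpa using LinearMap.congr_fun key h

/-- Hence `Ann(ℓ₁)·S + Ann(ℓ₂)·S ⊆ Ann(ℓ₁ ⊗ ℓ₂)` — "`J^{f+g,δ} ⊆ (J^{f+g}, P_{Z₁}·P_{Z₂})`" read for the
presented ideal `J^{f,[Z₁]}·S + J^{g,[Z₂]}·S`. [cite: DuqueFrancoVillaflor2025Join, Theorem 1.1 (proof)] -/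
theorem map_sup_map_annIdeal_le :
    (annIdeal ℓ₁).map (rename Sum.inl) ⊔ (annIdeal ℓ₂).map (rename Sum.inr) ≤
      annIdeal (tensorFunctional ℓ₁ ℓ₂) :=
  sup_le (map_rename_inl_annIdeal_le ℓ₁ ℓ₂) (map_rename_inr_annIdeal_le ℓ₁ ℓ₂)

/-! ## `Ann(ℓ₁ ⊗ ℓ₂) ⊆ Ann(ℓ₁)·S + Ann(ℓ₂)·S` (the perfect pairing of `R^{g,[Z₂]}`) -/

/-- **Reduction modulo `Ann(ℓ₂)·S` along dual families**: if `v ≡ Σ_i ℓ₂(v b_i) c_i (mod Ann ℓ₂)` for all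
`v ∈ K[y]`, then every `h ∈ K[x ⊔ y]` satisfies
`h ≡ Σ_i ((id ⊗ ℓ₂)(h·b_i(y)))(x) · c_i(y) (mod Ann(ℓ₂)·S)` ("`T = Σ_i T_i(x)·Ť_{e−i}(y)`" with the `y`-parts
running through a basis of `R^{g,[Z₂]}`). [cite: DuqueFrancoVillaflor2025Join, Theorem 1.1 (proof)] -/
theorem sub_sum_tensorContract_mul_mem {n : ℕ} (b c : Fin n → MvPolynomial τ K)
    (hspan : ∀ v : MvPolynomial τ K, v - ∑ i, ℓ₂ (v * b i) • c i ∈ annIdeal ℓ₂)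
    (h : MvPolynomial (σ ⊕ τ) K) :
    h - ∑ i, rename Sum.inl (tensorContract ℓ₂ (h * rename Sum.inr (b i))) * rename Sum.inr (c i) ∈
      (annIdeal ℓ₂).map (rename (Sum.inr : τ → σ ⊕ τ)) := by
  -- the reduction map `R(h) = h − Σ_i (id ⊗ ℓ₂)(h b_i)(x) c_i(y)` is `K`-linear; it lands in `Ann(ℓ₂)·S`
  -- because it does so on products `p(x) q(y)`: `R(pq) = p(x) · (q − Σ_i ℓ₂(q b_i) c_i)(y)`.
  set J : Ideal (MvPolynomial (σ ⊕ τ) K) := (annIdeal ℓ₂).map (rename (Sum.inr : τ → σ ⊕ τ)) with hJ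
  let R : MvPolynomial (σ ⊕ τ) K →ₗ[K] MvPolynomial (σ ⊕ τ) K :=
    LinearMap.id - ∑ i, LinearMap.mulRight K (rename Sum.inr (c i) : MvPolynomial (σ ⊕ τ) K) ∘ₗ
      (rename (Sum.inl : σ → σ ⊕ τ) : MvPolynomial σ K →ₐ[K] MvPolynomial (σ ⊕ τ) K).toLinearMap ∘ₗ
        tensorContract ℓ₂ ∘ₗ LinearMap.mulRight K (rename Sum.inr (b i) : MvPolynomial (σ ⊕ τ) K)
  have hR : ∀ h, R h = h - ∑ i, rename Sum.inl (tensorContract ℓ₂ (h * rename Sum.inr (b i))) *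
      rename Sum.inr (c i) := by
    intro h
    simp [R, LinearMap.sum_apply]
  have key : (J.restrictScalars K).mkQ ∘ₗ R = 0 := by
    refine linearMap_ext_of_mul_rename fun p q => ?_
    rw [LinearMap.zero_apply, LinearMap.comp_apply, hR, Submodule.mkQ_apply, Submodule.Quotient.mk_eq_zero,
      Submodule.restrictScalars_mem]
    have hcalc : rename Sum.inl p * rename Sum.inr q -
        ∑ i, rename Sum.inl (tensorContract ℓ₂ (rename Sum.inl p * rename Sum.inr q * rename Sum.inr (b i))) *
          rename Sum.inr (c i) =
        rename Sum.inl p * rename (Sum.inr : τ → σ ⊕ τ) (q - ∑ i, ℓ₂ (q * b i) • c i) := by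
      simp_rw [mul_assoc, ← map_mul (rename (Sum.inr : τ → σ ⊕ τ)), tensorContract_mul_rename, map_smul,
        smul_mul_assoc, ← mul_smul_comm, ← Finset.mul_sum, ← mul_sub, map_sub, map_sum, map_smul]
    rw [hcalc]
    exact J.mul_mem_left _ (Ideal.mem_map_of_mem _ (hspan q))
  have hh := LinearMap.congr_fun key h
  rw [LinearMap.zero_apply, LinearMap.comp_apply, hR, Submodule.mkQ_apply, Submodule.Quotient.mk_eq_zero,
    Submodule.restrictScalars_mem] at hh
  exact hh

/-- **The coefficients `T_i(x)` lie in `Ann(ℓ₁)`**: for `h ∈ Ann(ℓ₁ ⊗ ℓ₂)` and any `b ∈ K[y]`,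
`(id ⊗ ℓ₂)(h·b(y)) ∈ Ann(ℓ₁)`, because `ℓ₁((id ⊗ ℓ₂)(h b)·a) = (ℓ₁ ⊗ ℓ₂)(h·b(y)a(x)) = 0`.
[cite: DuqueFrancoVillaflor2025Join, Theorem 1.1 (proof)] -/
theorem tensorContract_mul_mem_annIdeal {h : MvPolynomial (σ ⊕ τ) K}
    (hh : h ∈ annIdeal (tensorFunctional ℓ₁ ℓ₂)) (b : MvPolynomial τ K) :
    tensorContract ℓ₂ (h * rename Sum.inr b) ∈ annIdeal ℓ₁ := by
  intro a
  rw [← tensorContract_mul_rename_inl, ← tensorFunctional_apply, mul_assoc]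
  exact hh _

/-- **`Ann(ℓ₁ ⊗ ℓ₂) ⊆ Ann(ℓ₁)·S + Ann(ℓ₂)·S`** when `K[y]/Ann(ℓ₂)` is finite-dimensional: reduce `h` modulo
`Ann(ℓ₂)·S` along dual families of the perfect pairing of `K[y]/Ann(ℓ₂)`; the coefficients lie in `Ann(ℓ₁)`.
[cite: DuqueFrancoVillaflor2025Join, Theorem 1.1 (proof)] -/
theorem annIdeal_tensorFunctional_le
    [FiniteDimensional K (MvPolynomial τ K ⧸ (annIdeal ℓ₂).restrictScalars K)] :
    annIdeal (tensorFunctional ℓ₁ ℓ₂) ≤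
      (annIdeal ℓ₁).map (rename Sum.inl) ⊔ (annIdeal ℓ₂).map (rename Sum.inr) := by
  obtain ⟨n, b, c, -, hspan⟩ := exists_dual_families ℓ₂
  intro h hh
  have h₂ := sub_sum_tensorContract_mul_mem ℓ₂ b c hspan h
  have h₁ : ∑ i, rename Sum.inl (tensorContract ℓ₂ (h * rename Sum.inr (b i))) * rename Sum.inr (c i) ∈
      (annIdeal ℓ₁).map (rename (Sum.inl : σ → σ ⊕ τ)) :=
    Ideal.sum_mem _ fun i _ =>
      Ideal.mul_mem_right _ _ (Ideal.mem_map_of_mem _ (tensorContract_mul_mem_annIdeal ℓ₁ ℓ₂ hh (b i)))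
  have := Submodule.add_mem_sup h₁ h₂
  rwa [add_sub_cancel] at this

/-- **Theorem 1.1 (algebraic core): `Ann(ℓ₁ ⊗ ℓ₂) = Ann(ℓ₁)·S + Ann(ℓ₂)·S`**, i.e.
`K[x ⊔ y]/Ann(ℓ₁ ⊗ ℓ₂) = K[x]/Ann(ℓ₁) ⊗ K[y]/Ann(ℓ₂)` — "`R^{f+g,δ} = R^{f,[Z₁]} ⊗ R^{g,[Z₂]}`" for
`δ ↔ ℓ₁ ⊗ ℓ₂` — whenever `K[y]/Ann(ℓ₂)` is finite-dimensional (e.g. `ℓ₂` concentrated in one degree, `τ`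
finite: `finiteDimensional_quotient_annIdeal`). [cite: DuqueFrancoVillaflor2025Join, Theorem 1.1] -/
theorem annIdeal_tensorFunctional
    [FiniteDimensional K (MvPolynomial τ K ⧸ (annIdeal ℓ₂).restrictScalars K)] :
    annIdeal (tensorFunctional ℓ₁ ℓ₂) =
      (annIdeal ℓ₁).map (rename Sum.inl) ⊔ (annIdeal ℓ₂).map (rename Sum.inr) :=
  le_antisymm (annIdeal_tensorFunctional_le ℓ₁ ℓ₂) (map_sup_map_annIdeal_le ℓ₁ ℓ₂)

/-- Finite codimension is inherited by `Ann(ℓ(·Q)) = (Ann ℓ : Q) ⊇ Ann ℓ`. [folklore] -/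
private theorem finiteDimensional_quotient_annIdeal_comp_mulRight (Q : MvPolynomial τ K)
    [FiniteDimensional K (MvPolynomial τ K ⧸ (annIdeal ℓ₂).restrictScalars K)] :
    FiniteDimensional K (MvPolynomial τ K ⧸ (annIdeal (ℓ₂ ∘ₗ LinearMap.mulRight K Q)).restrictScalars K) :=
  Module.Finite.of_surjective
    (Submodule.factor ((Submodule.restrictScalars_le K).mpr (annIdeal_le_annIdeal_comp_mulRight ℓ₂ Q)))
    (Submodule.factor_surjective _)

/-- **Theorem 1.1, the printed identity of ideals**: for ALL `P ∈ K[x]`, `Q ∈ K[y]`,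
`((Ann ℓ₁·S + Ann ℓ₂·S) : P(x)Q(y)) = (Ann ℓ₁ : P)·S + (Ann ℓ₂ : Q)·S`. With `J^f = Ann ℓ_f`, `J^g = Ann ℓ_g`
(Macaulay) and `J^{f+g} = J^f·S + J^g·S`: "`(J^{f+g}, P_{Z₁}·P_{Z₂}) = J^{f+g,[J(Z₁,Z₂)]}`" equals
`J^{f,[Z₁]}·S + J^{g,[Z₂]}·S`, i.e. `R^{f+g,[J(Z₁,Z₂)]} = R^{f,[Z₁]} ⊗ R^{g,[Z₂]}` (granted
`P_{J(Z₁,Z₂)} = P_{Z₁}·P_{Z₂}`). [cite: DuqueFrancoVillaflor2025Join, Theorem 1.1] -/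
theorem colon_map_sup_map_annIdeal
    [FiniteDimensional K (MvPolynomial τ K ⧸ (annIdeal ℓ₂).restrictScalars K)]
    (P : MvPolynomial σ K) (Q : MvPolynomial τ K) :
    ((annIdeal ℓ₁).map (rename Sum.inl) ⊔ (annIdeal ℓ₂).map (rename Sum.inr)).colon
        {rename Sum.inl P * rename Sum.inr Q} =
      ((annIdeal ℓ₁).colon {P}).map (rename Sum.inl) ⊔ ((annIdeal ℓ₂).colon {Q}).map (rename Sum.inr) := by
  haveI := finiteDimensional_quotient_annIdeal_comp_mulRight ℓ₂ Q
  rw [← annIdeal_tensorFunctional, ← annIdeal_comp_mulRight, tensorFunctional_comp_mulRight,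
    annIdeal_tensorFunctional, annIdeal_comp_mulRight, annIdeal_comp_mulRight]

end Tensor

/-! ## Graded functionals: socle degrees add, and `R^f ⊗ R^g` is Artinian Gorenstein -/

section Graded

variable {K : Type*} [Field K] {σ τ : Type*}

/-- Splitting an exponent `s` on `σ ⊕ τ` into its `σ`-part `s₁` and `τ`-part `s₂`:
`s = s₁ ∘ inl⁻¹ + s₂ ∘ inr⁻¹`. [folklore] -/
private theorem eq_mapDomain_add_mapDomain (s : σ ⊕ τ →₀ ℕ) :
    s = (Finsupp.sumFinsuppEquivProdFinsupp s).1.mapDomain Sum.inl +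
      (Finsupp.sumFinsuppEquivProdFinsupp s).2.mapDomain Sum.inr := by
  ext x
  rcases x with i | j
  · rw [Finsupp.add_apply, Finsupp.mapDomain_apply Sum.inl_injective,
      Finsupp.mapDomain_notin_range _ _ (by simp), add_zero, Finsupp.fst_sumFinsuppEquivProdFinsupp]
  · rw [Finsupp.add_apply, Finsupp.mapDomain_notin_range _ _ (by simp),
      Finsupp.mapDomain_apply Sum.inr_injective, zero_add, Finsupp.snd_sumFinsuppEquivProdFinsupp]

/-- Monomials are pure tensors: `x^s = x^{s₁}(x) · y^{s₂}(y)` in `K[x,y] = K[x] ⊗ K[y]`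
("`C(J(Z₁,Z₂)) = C(Z₁) × C(Z₂)`", `S(J(Z₁,Z₂)) = S(Z₁) ⊗ S(Z₂)`).
[cite: DuqueFrancoVillaflor2025Join, §1 (display after "in terms of their homogeneous coordinate rings")] -/
theorem monomial_eq_rename_mul_rename (s : σ ⊕ τ →₀ ℕ) (c : K) :
    monomial s c = rename Sum.inl (monomial (Finsupp.sumFinsuppEquivProdFinsupp s).1 c) *
      rename Sum.inr (monomial (Finsupp.sumFinsuppEquivProdFinsupp s).2 (1 : K)) := by
  rw [rename_monomial, rename_monomial, monomial_mul, mul_one, ← eq_mapDomain_add_mapDomain]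

/-- … with degrees adding up: `|s| = |s₁| + |s₂|` (the grading of `S(Z₁) ⊗ S(Z₂)`, as used in Cor. 6.1
"`HF_{[J(Z₁,Z₂)]}(k) = Σ_{p+q=k} HF_{[Z₁]}(p)·HF_{[Z₂]}(q)`"). [cite: DuqueFrancoVillaflor2025Join, Corollary 6.1] -/
theorem degree_eq_degree_add_degree (s : σ ⊕ τ →₀ ℕ) :
    s.degree = (Finsupp.sumFinsuppEquivProdFinsupp s).1.degree +
      (Finsupp.sumFinsuppEquivProdFinsupp s).2.degree := by
  conv_lhs => rw [eq_mapDomain_add_mapDomain s]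
  rw [map_add, Finsupp.degree_mapDomain, Finsupp.degree_mapDomain]

variable {t₁ t₂ : ℕ} {ℓ₁ : MvPolynomial σ K →ₗ[K] K} {ℓ₂ : MvPolynomial τ K →ₗ[K] K}

/-- `(ℓ₁ ⊗ ℓ₂)(x^s) = 0` unless `|s| = t₁ + t₂`, for `ℓ_j` concentrated in degree `t_j`.
[cite: DuqueFrancoVillaflor2025Join, Theorem 1.1 (proof)] -/
theorem tensorFunctional_monomial_eq_zero (hℓ₁ : ∀ p, ℓ₁ (homogeneousComponent t₁ p) = ℓ₁ p)
    (hℓ₂ : ∀ p, ℓ₂ (homogeneousComponent t₂ p) = ℓ₂ p) {s : σ ⊕ τ →₀ ℕ} (hs : s.degree ≠ t₁ + t₂) (c : K) :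
    tensorFunctional ℓ₁ ℓ₂ (monomial s c) = 0 := by
  rw [monomial_eq_rename_mul_rename s c, tensorFunctional_mul_rename]
  rw [degree_eq_degree_add_degree] at hs
  by_cases h₁ : (Finsupp.sumFinsuppEquivProdFinsupp s).1.degree = t₁
  · have h₂ : (Finsupp.sumFinsuppEquivProdFinsupp s).2.degree ≠ t₂ := by omega
    rw [apply_eq_zero_of_isHomogeneous_ne hℓ₂ (isHomogeneous_monomial _ rfl) h₂, mul_zero]
  · rw [apply_eq_zero_of_isHomogeneous_ne hℓ₁ (isHomogeneous_monomial _ rfl) h₁, zero_mul]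

/-- **Socle degrees add: `ℓ₁ ⊗ ℓ₂` is concentrated in degree `t₁ + t₂`** when `ℓ_j` is concentrated in
degree `t_j` ("`R^{f+g}` is Artinian Gorenstein of socle in degree `(d−2)(n+2)`" `= (d−2)(k+2) + (d−2)(n−k)`;
`f-dim(H' ⊗ H'') = f-dim H' + f-dim H''`). [cite: DuqueFrancoVillaflor2025Join, Theorem 1.1 (proof)]
[cite: MeyerSmith2005, §I.1] -/
theorem tensorFunctional_homogeneousComponent (hℓ₁ : ∀ p, ℓ₁ (homogeneousComponent t₁ p) = ℓ₁ p)
    (hℓ₂ : ∀ p, ℓ₂ (homogeneousComponent t₂ p) = ℓ₂ p) (p : MvPolynomial (σ ⊕ τ) K) :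
    tensorFunctional ℓ₁ ℓ₂ (homogeneousComponent (t₁ + t₂) p) = tensorFunctional ℓ₁ ℓ₂ p := by
  classical
  conv_rhs => rw [p.as_sum, map_sum]
  rw [homogeneousComponent_apply, map_sum, ← Finset.sum_filter_add_sum_filter_not p.support
    (fun d => d.degree = t₁ + t₂) (fun d => tensorFunctional ℓ₁ ℓ₂ (monomial d (coeff d p)))]
  rw [Finset.sum_eq_zero (s := p.support.filter fun d => ¬ d.degree = t₁ + t₂) fun d hd =>
    tensorFunctional_monomial_eq_zero hℓ₁ hℓ₂ (Finset.mem_filter.mp hd).2 _, add_zero]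

/-- `ℓ₁ ⊗ ℓ₂ ≠ 0` when both factors are non-zero. [cite: MeyerSmith2005, §I.1] -/
theorem tensorFunctional_ne_zero (h₁ : ℓ₁ ≠ 0) (h₂ : ℓ₂ ≠ 0) : tensorFunctional ℓ₁ ℓ₂ ≠ 0 := by
  obtain ⟨p, hp⟩ : ∃ p, ℓ₁ p ≠ 0 := by
    by_contra H
    push Not at H
    exact h₁ (LinearMap.ext fun p => by simpa using H p)
  obtain ⟨q, hq⟩ : ∃ q, ℓ₂ q ≠ 0 := by
    by_contra H
    push Not at H
    exact h₂ (LinearMap.ext fun q => by simpa using H q)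
  intro H
  have := LinearMap.congr_fun H (rename Sum.inl p * rename Sum.inr q)
  rw [tensorFunctional_mul_rename, LinearMap.zero_apply] at this
  exact mul_ne_zero hp hq this

/-- **A functional concentrated in one degree has `Ann` of finite codimension** (`τ` finite): `K[y]/Ann(ℓ)` is
spanned by the classes of the forms of degree `≤ t`, since every form of degree `> t` lies in `Ann(ℓ)`
(`(S/I)_{>t} = 0`, Kloosterman Lemma 2.1 / Def. 2.1 (i)). [cite: DuqueFrancoVillaflor2025Join, Definition 2.1 (i)]
[cite: Kloosterman2025, Lemma 2.1] -/
theorem finiteDimensional_quotient_annIdeal [Finite τ] {t : ℕ} {ℓ : MvPolynomial τ K →ₗ[K] K}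
    (hℓ : ∀ p, ℓ (homogeneousComponent t p) = ℓ p) :
    FiniteDimensional K (MvPolynomial τ K ⧸ (annIdeal ℓ).restrictScalars K) := by
  classical
  set N : Submodule K (MvPolynomial τ K) := (annIdeal ℓ).restrictScalars K with hN
  -- the forms of degree `≤ t`
  let W : Submodule K (MvPolynomial τ K) := ⨆ e : Fin (t + 1), homogeneousSubmodule τ K (e : ℕ)
  haveI : ∀ e : Fin (t + 1), Module.Finite K (homogeneousSubmodule τ K (e : ℕ)) := fun e =>
    finite_homogeneousSubmodule (K := K) (σ := τ) (e : ℕ)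
  haveI : Module.Finite K W := Submodule.finite_iSup _
  -- `W + N = S`
  have htop : W ⊔ N = ⊤ := by
    refine eq_top_iff.mpr fun p _ => ?_
    rw [← sum_homogeneousComponent p, ← Finset.sum_filter_add_sum_filter_not (Finset.range (p.totalDegree + 1))
      (fun e => e ≤ t)]
    refine Submodule.add_mem_sup (Submodule.sum_mem _ fun e he => ?_) (Submodule.sum_mem _ fun e he => ?_)
    · have hle : e ≤ t := (Finset.mem_filter.mp he).2
      exact Submodule.mem_iSup_of_mem (⟨e, by omega⟩ : Fin (t + 1)) (homogeneousComponent_mem e p)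
    · have hlt : t < e := by have := (Finset.mem_filter.mp he).2; omega
      exact mem_annIdeal_of_isHomogeneous_of_lt hℓ (homogeneousComponent_isHomogeneous e p) hlt
  have hsurj : Function.Surjective (N.mkQ ∘ₗ W.subtype) := by
    rw [← LinearMap.range_eq_top, LinearMap.range_comp, Submodule.range_subtype, Submodule.map_mkQ_eq_top,
      sup_comm, htop]
  exact Module.Finite.of_surjective _ hsurj

/-- Hence, for `ℓ₂` concentrated in one degree and finitely many `y`-variables, Theorem 1.1's identity holds
with no further hypothesis: `Ann(ℓ₁ ⊗ ℓ₂) = Ann(ℓ₁)·S + Ann(ℓ₂)·S`. [cite: DuqueFrancoVillaflor2025Join, Theorem 1.1] -/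
theorem annIdeal_tensorFunctional_of_homogeneousComponent [Finite τ]
    (hℓ₂ : ∀ p, ℓ₂ (homogeneousComponent t₂ p) = ℓ₂ p) :
    annIdeal (tensorFunctional ℓ₁ ℓ₂) =
      (annIdeal ℓ₁).map (rename Sum.inl) ⊔ (annIdeal ℓ₂).map (rename Sum.inr) := by
  haveI := finiteDimensional_quotient_annIdeal hℓ₂
  exact annIdeal_tensorFunctional ℓ₁ ℓ₂

/-- **"`R^f ⊗ R^g` is Artinian Gorenstein, of socle the sum of the socles"**: if `I₁ ⊆ K[x]` is Artinian
Gorenstein of socle `σ₁` and `I₂ ⊆ K[y]` of socle `σ₂` (Def. 2.1), then `I₁·S + I₂·S ⊆ S = K[x ⊔ y]` is Artinian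
Gorenstein of socle `σ₁ + σ₂` (`S/(I₁S + I₂S) = K[x]/I₁ ⊗ K[y]/I₂`; the tensor product of Poincaré duality
algebras is one, of formal dimension the sum). For `I₁ = J^f`, `I₂ = J^g`: "`R^{f+g} = R^f ⊗ R^g` … is Artinian
Gorenstein of socle in degree `(d−2)(n+2)`". [cite: DuqueFrancoVillaflor2025Join, Theorem 1.1 (proof)]
[cite: MeyerSmith2005, §I.1] -/
theorem isArtinianGorenstein_join [Finite σ] [Finite τ] {I₁ : Ideal (MvPolynomial σ K)}
    {I₂ : Ideal (MvPolynomial τ K)} {σ₁ σ₂ : ℕ} (h₁ : IsArtinianGorenstein I₁ σ₁)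
    (h₂ : IsArtinianGorenstein I₂ σ₂) :
    IsArtinianGorenstein (I₁.map (rename Sum.inl) ⊔ I₂.map (rename Sum.inr) :
      Ideal (MvPolynomial (σ ⊕ τ) K)) (σ₁ + σ₂) := by
  obtain ⟨ℓ₁, hℓ₁, hne₁, rfl⟩ := h₁.exists_eq_annIdeal
  obtain ⟨ℓ₂, hℓ₂, hne₂, rfl⟩ := h₂.exists_eq_annIdeal
  rw [← annIdeal_tensorFunctional_of_homogeneousComponent hℓ₂]
  exact isArtinianGorenstein_annIdeal (tensorFunctional_homogeneousComponent hℓ₁ hℓ₂)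
    (tensorFunctional_ne_zero hne₁ hne₂)

/-- **Theorem 1.1 for Artinian Gorenstein ideals**: for `I₁ ⊆ K[x]`, `I₂ ⊆ K[y]` Artinian Gorenstein (of any
socles) and ALL `P ∈ K[x]`, `Q ∈ K[y]`:
`((I₁·S + I₂·S) : P(x)Q(y)) = (I₁ : P)·S + (I₂ : Q)·S` — with `I₁ = J^f`, `I₂ = J^g`, `J^{f+g} = J^f·S + J^g·S`
this is `J^{f+g,[J(Z₁,Z₂)]} = (J^{f+g} : P_{Z₁}P_{Z₂}) = J^{f,[Z₁]}·S + J^{g,[Z₂]}·S`, i.e.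
`R^{f+g,[J(Z₁,Z₂)]} = R^{f,[Z₁]} ⊗ R^{g,[Z₂]}`. [cite: DuqueFrancoVillaflor2025Join, Theorem 1.1] -/
theorem IsArtinianGorenstein.colon_join [Finite σ] [Finite τ] {I₁ : Ideal (MvPolynomial σ K)}
    {I₂ : Ideal (MvPolynomial τ K)} {σ₁ σ₂ : ℕ} (h₁ : IsArtinianGorenstein I₁ σ₁)
    (h₂ : IsArtinianGorenstein I₂ σ₂) (P : MvPolynomial σ K) (Q : MvPolynomial τ K) :
    (I₁.map (rename Sum.inl) ⊔ I₂.map (rename Sum.inr) : Ideal (MvPolynomial (σ ⊕ τ) K)).colon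
        {rename Sum.inl P * rename Sum.inr Q} =
      (I₁.colon {P}).map (rename Sum.inl) ⊔ (I₂.colon {Q}).map (rename Sum.inr) := by
  obtain ⟨ℓ₁, hℓ₁, -, rfl⟩ := h₁.exists_eq_annIdeal
  obtain ⟨ℓ₂, hℓ₂, -, rfl⟩ := h₂.exists_eq_annIdeal
  haveI := finiteDimensional_quotient_annIdeal hℓ₂
  exact colon_map_sup_map_annIdeal ℓ₁ ℓ₂ P Q

/-- … and the socle bookkeeping of Def. 2.2 for the join: if `P ∉ I₁` has degree `e₁` with `e₁ + s₁ = σ₁` and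
`Q ∉ I₂` has degree `e₂` with `e₂ + s₂ = σ₂`, then `((I₁·S + I₂·S) : PQ)` is Artinian Gorenstein of socle
`s₁ + s₂` (`= (d−2)(k/2+1) + (d−2)((n−k)/2) = (d−2)(n/2+1)`). [cite: DuqueFrancoVillaflor2025Join, Theorem 1.1]
[cite: DuqueFrancoVillaflor2025Join, Definition 2.2] -/
theorem IsArtinianGorenstein.colon_join_isArtinianGorenstein [Finite σ] [Finite τ]
    {I₁ : Ideal (MvPolynomial σ K)} {I₂ : Ideal (MvPolynomial τ K)} {σ₁ σ₂ : ℕ}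
    (h₁ : IsArtinianGorenstein I₁ σ₁) (h₂ : IsArtinianGorenstein I₂ σ₂) {P : MvPolynomial σ K}
    {Q : MvPolynomial τ K} {e₁ s₁ e₂ s₂ : ℕ} (hP : P.IsHomogeneous e₁) (hes₁ : e₁ + s₁ = σ₁) (hPI : P ∉ I₁)
    (hQ : Q.IsHomogeneous e₂) (hes₂ : e₂ + s₂ = σ₂) (hQI : Q ∉ I₂) :
    IsArtinianGorenstein ((I₁.map (rename Sum.inl) ⊔ I₂.map (rename Sum.inr) :
      Ideal (MvPolynomial (σ ⊕ τ) K)).colon {rename Sum.inl P * rename Sum.inr Q}) (s₁ + s₂) := by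
  rw [h₁.colon_join h₂]
  exact isArtinianGorenstein_join (h₁.colon hP hes₁ hPI) (h₂.colon hQ hes₂ hQI)

end Graded

end Literature.AlgebraicGeometry.DuqueFrancoVillaflor2025

end
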